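import Literature.Computability.Complexity.InstanceCompression
import Literature.Computability.Complexity.CodeFPArith
import HarnessLib

/-!
# Instance compression: proof of the Complementary Witness Lemma (mapping case)

Discharge of the named fact `Literature.Computability.Complexity.complementaryWitness_mapping`
(`InstanceCompression.lean`): **Dell–van Melkebeek, Lemma 4 (Complementary Witness Lemma)**, in the
case of a deterministic polynomial-time mapping compression `f` into an arbitrary set `A` — the case
the authors credit to Fortnow–Santhanam (J. ACM 61 (2014) Art. 23, §6.1): if every `t(s)`-tuple of
strings of length `≤ s` is mapped (with `1ˢ`) to a string of length `c(s) = O(t(s) log t(s))` whose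
membership in `A` is the OR of the memberships in `L`, then `L ∈ coNP/poly`.

We FOLLOW THE PRINTED PROOF (§6.1, deterministic protocols), with `s := n = |x|`:

* **Pigeonhole step** (`ComplementaryWitness.cover_step`): for a set `F` of non-members, the
  `|F|^t` tuples over `F` have fewer than `2^{c+1}` compressed values, so the most frequent value is
  hit by `≥ |F|^t / 2^{c+1}` tuples, whose coordinates form a set `G` with `|G|^t ≥ |F|^t / 2^{c+1}`:
  "every step covers a fraction at least `φ(s) = 2^{-(c(s)+1)/t(s)}` of the remaining instances".
  We use an integer ratio `D` with `D^t ≥ 2^{c+1}`, so `D |G| ≥ |F|`.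
* **Greedy iteration** (`ComplementaryWitness.greedy_cover`): "since there are at most `2ˢ`
  instances of bitlength `s` to begin with ... the process ends after `O(s/φ(s))` steps" — counted
  in `ℕ`: `D` steps halve the uncovered set (`greedy_halve`), `D (n + 1)` steps empty it.
* **`1/φ` is polynomial** (`two_pow_le_pow_mul`): from `c(n) ≤ C t(n) log t(n)` (natural log, real
  `C`, `n ≥ s₀`), `2^{c(n)} ≤ t(n)^{⌈C⌉₊ t(n)}`, so `D(n) := 2 t(n)^{⌈C⌉₊}` works; for the finitely
  many `n < s₀` we take `D(n) := 2^{c(n)+1}` (same construction, size absorbed in a constant).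
* **The proof system** (`ComplementaryWitness.vbit`, `exists_verifier`): advice at length `n` is
  `⟨1^{t(n)}, encList Yₙ⟩` with `Yₙ` the chosen values (all outside `A`, by correctness of `f` on
  tuples of non-members); `x ∉ L` iff some witness `y`, read as `t(n)` nested-pair items
  (`items`, total in `y`), lists strings of length `≤ n` containing `x` whose compressed value
  `f ⟨encList items, 1ⁿ⟩` is in `Yₙ` (soundness: a value outside `A` certifies that no coordinate is
  in `L`; completeness: the cover). The verifier is polynomial time by the tree's `CodeFP` algebra
  (`CodeFP.lean`, `CodeFPArith.lean`: `map`, `all`, `mem`, `urange`, `HashBricks.nthItemFn`), so the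
  language `K` of pairs `⟨x, advice⟩` with a witness is in `NP = polyExists P`, and `L` agrees with
  `Kᶜ ∈ coNP` under the advice: `L ∈ polyAdvice coNP`.
* **Advice length**: `|Yₙ| ≤ D(n)(n+1)`, each value of length `≤ c(n) ≤ ⌈C⌉₊ t(n)²`, `t(n) ≤ p(n)`.

Deviations from print: none in substance; the real-valued bound `(1 - φ)^k 2ˢ ≤ exp(-φ k) 2ˢ` is
replaced by the integer halving count, and tuples are functions `Fin t → {0,1}*` for the counting
(`Fintype.piFinset`) and nested-pair lists `encList` for the machines.

## References

* [DellVanmelkebeek2014] H. Dell, D. van Melkebeek, *Satisfiability allows no nontrivial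
  sparsification unless the polynomial-time hierarchy collapses*, J. ACM 61 (2014) Art. 23,
  Lemma 4 (p. 23:13) and §6.1 (proof of the lemma; the Fortnow–Santhanam mapping case) — held,
  key paper:doi-10-1145-2629620, chunks 13, 25–26.
* [FortnowSanthanam2011] L. Fortnow, R. Santhanam, *Infeasibility of instance compression and
  succinct PCPs for NP*, J. Comput. System Sci. 77 (2011) 91–106, Thm. 3.1 (the original argument).
* [AroraBarak2009] S. Arora, B. Barak, *Computational Complexity: A Modern Approach*, CUP 2009,
  §0.1 (codes), §1.3 (closure of polynomial time), Def. 2.1 (NP by certificates), Def. 6.16 (advice).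
-/

namespace Literature.Computability.Complexity

open _root_.Computability Brick HashBricks CodeFP Finset Polynomial

namespace ComplementaryWitness


section Greedy

open scoped Classical

variable {α β : Type*}

/-- The elements of `B` covered by none of the chosen values `vs`. [folklore] -/
noncomputable def uncovered (cov : β → α → Prop) (B : Finset α) (vs : List β) : Finset α :=
  B.filter fun x => ∀ v ∈ vs, ¬ cov v x

/-- Membership in the uncovered part. [folklore] -/
theorem mem_uncovered {cov : β → α → Prop} {B : Finset α} {vs : List β} {x : α} :
    x ∈ uncovered cov B vs ↔ x ∈ B ∧ ∀ v ∈ vs, ¬ cov v x := by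
  simp [uncovered]

/-- The uncovered part is a part of `B`. [folklore] -/
theorem uncovered_subset (cov : β → α → Prop) (B : Finset α) (vs : List β) :
    uncovered cov B vs ⊆ B := filter_subset _ _

/-- One more chosen value removes the elements it covers. [folklore] -/
theorem uncovered_append_singleton (cov : β → α → Prop) (B : Finset α) (vs : List β) (v : β) :
    uncovered cov B (vs ++ [v]) = (uncovered cov B vs).filter fun x => ¬ cov v x := by
  ext x
  simp only [mem_uncovered, mem_filter, List.mem_append, List.mem_singleton]
  constructor
  · rintro ⟨hx, h⟩
    exact ⟨⟨hx, fun u hu => h u (Or.inl hu)⟩, h v (Or.inr rfl)⟩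
  · rintro ⟨⟨hx, h⟩, hv⟩
    refine ⟨hx, fun u hu => ?_⟩
    rcases hu with hu | rfl
    · exact h u hu
    · exact hv

/-- `j` greedy steps: either the uncovered part of `B` has already been halved, or the covered
part has grown by at least `j |B| / (2D)`. [cite: DellVanmelkebeek2014, §6.1 proof of Lemma 4] -/
theorem greedy_steps (B₀ : Finset α) (cov : β → α → Prop) (good : β → Prop) (D : ℕ)
    (step : ∀ B ⊆ B₀, B.Nonempty → ∃ v, good v ∧ ∃ S ⊆ B, (∀ x ∈ S, cov v x) ∧ B.card ≤ D * S.card)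
    (B : Finset α) (hB : B ⊆ B₀) :
    ∀ j : ℕ, ∃ vs : List β, vs.length ≤ j ∧ (∀ v ∈ vs, good v) ∧
      (2 * (uncovered cov B vs).card ≤ B.card ∨
        j * B.card ≤ 2 * D * (B.card - (uncovered cov B vs).card))
  | 0 => ⟨[], le_rfl, fun v hv => by simp at hv, Or.inr (by simp)⟩
  | j + 1 => by
    obtain ⟨vs, hlen, hgood, h⟩ := greedy_steps B₀ cov good D step B hB j
    rcases h with h | h
    · exact ⟨vs, hlen.trans (Nat.le_succ j), hgood, Or.inl h⟩
    by_cases hhalf : 2 * (uncovered cov B vs).card ≤ B.card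
    · exact ⟨vs, hlen.trans (Nat.le_succ j), hgood, Or.inl hhalf⟩
    set R := uncovered cov B vs with hR
    have hRB : R ⊆ B := uncovered_subset cov B vs
    have hRne : R.Nonempty := by
      rw [← card_pos]
      omega
    obtain ⟨v, hv, S, hSR, hScov, hstep⟩ := step R (hRB.trans hB) hRne
    refine ⟨vs ++ [v], by simp [hlen], fun u hu => ?_, Or.inr ?_⟩
    · rcases List.mem_append.1 hu with hu | hu
      · exact hgood u hu
      · rw [List.mem_singleton.1 hu]; exact hv
    rw [uncovered_append_singleton, ← hR]
    have hsplit := card_filter_add_card_filter_not (s := R) (cov v)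
    have hSle : S.card ≤ (R.filter (cov v)).card :=
      card_le_card fun x hx => mem_filter.2 ⟨hSR hx, hScov x hx⟩
    have hR'le : (R.filter fun x => ¬ cov v x).card ≤ R.card := card_le_card (filter_subset _ _)
    have hRcard : R.card ≤ B.card := card_le_card hRB
    have h1 : B.card < 2 * R.card := by omega
    have h2 : B.card ≤ 2 * D * (R.filter (cov v)).card := by nlinarith
    have h3 : (R.filter (cov v)).card = R.card - (R.filter fun x => ¬ cov v x).card := by omega
    rw [h3] at h2
    have h4 : j * B.card + B.card ≤ 2 * D * (B.card - R.card) + 2 * D * (R.card - (R.filter fun x => ¬ cov v x).card) :=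
      Nat.add_le_add h h2
    calc (j + 1) * B.card = j * B.card + B.card := by ring
      _ ≤ 2 * D * (B.card - R.card) + 2 * D * (R.card - (R.filter fun x => ¬ cov v x).card) := h4
      _ = 2 * D * (B.card - (R.filter fun x => ¬ cov v x).card) := by
          rw [← Nat.mul_add]
          congr 1
          omega

/-- `D` greedy steps halve the uncovered part. [cite: DellVanmelkebeek2014, §6.1 proof of Lemma 4] -/
theorem greedy_halve (B₀ : Finset α) (cov : β → α → Prop) (good : β → Prop) {D : ℕ} (hD : 1 ≤ D)
    (step : ∀ B ⊆ B₀, B.Nonempty → ∃ v, good v ∧ ∃ S ⊆ B, (∀ x ∈ S, cov v x) ∧ B.card ≤ D * S.card)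
    (B : Finset α) (hB : B ⊆ B₀) :
    ∃ vs : List β, vs.length ≤ D ∧ (∀ v ∈ vs, good v) ∧ 2 * (uncovered cov B vs).card ≤ B.card := by
  obtain ⟨vs, hlen, hgood, h⟩ := greedy_steps B₀ cov good D step B hB D
  refine ⟨vs, hlen, hgood, ?_⟩
  rcases h with h | h
  · exact h
  · have hRcard : (uncovered cov B vs).card ≤ B.card := card_le_card (uncovered_subset cov B vs)
    have h' : D * B.card ≤ D * (2 * (B.card - (uncovered cov B vs).card)) := by
      calc D * B.card ≤ 2 * D * (B.card - (uncovered cov B vs).card) := h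
        _ = D * (2 * (B.card - (uncovered cov B vs).card)) := by ring
    have h'' : B.card ≤ 2 * (B.card - (uncovered cov B vs).card) := Nat.le_of_mul_le_mul_left h' hD
    omega

/-- **Greedy covering**: if every nonempty part `B` of `B₀` admits a good value covering at least a
`1/D` fraction of `B`, and `|B₀| ≤ 2^m`, then `D (m + 1)` good values cover `B₀` (printed: "every
step covers a fraction at least `φ(s)` of the remaining instances ... so the process ends after
`O(s/φ(s))` steps"; here `φ = 1/D` and the halving is counted in `ℕ`).
[cite: DellVanmelkebeek2014, §6.1 proof of Lemma 4] -/
theorem greedy_cover (B₀ : Finset α) (cov : β → α → Prop) (good : β → Prop) {D : ℕ} (hD : 1 ≤ D)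
    (step : ∀ B ⊆ B₀, B.Nonempty → ∃ v, good v ∧ ∃ S ⊆ B, (∀ x ∈ S, cov v x) ∧ B.card ≤ D * S.card) :
    ∀ (m : ℕ) (B : Finset α), B ⊆ B₀ → B.card ≤ 2 ^ m →
      ∃ vs : List β, vs.length ≤ D * (m + 1) ∧ (∀ v ∈ vs, good v) ∧ ∀ x ∈ B, ∃ v ∈ vs, cov v x
  | 0, B, hB, hcard => by
    obtain ⟨vs, hlen, hgood, h⟩ := greedy_halve B₀ cov good hD step B hB
    refine ⟨vs, by simpa using hlen, hgood, fun x hx => ?_⟩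
    have h0 : (uncovered cov B vs).card = 0 := by
      simp only [pow_zero] at hcard
      omega
    have hx' : x ∉ uncovered cov B vs := by
      rw [card_eq_zero] at h0
      simp [h0]
    rw [mem_uncovered] at hx'
    push Not at hx'
    exact hx' hx
  | m + 1, B, hB, hcard => by
    obtain ⟨vs, hlen, hgood, h⟩ := greedy_halve B₀ cov good hD step B hB
    have hR : (uncovered cov B vs).card ≤ 2 ^ m := by
      rw [pow_succ] at hcard
      omega
    obtain ⟨vs', hlen', hgood', h'⟩ :=
      greedy_cover B₀ cov good hD step m (uncovered cov B vs) ((uncovered_subset cov B vs).trans hB) hR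
    refine ⟨vs ++ vs', ?_, fun v hv => ?_, fun x hx => ?_⟩
    · rw [List.length_append]
      calc vs.length + vs'.length ≤ D + D * (m + 1) := Nat.add_le_add hlen hlen'
        _ = D * (m + 1 + 1) := by ring
    · rcases List.mem_append.1 hv with hv | hv
      · exact hgood v hv
      · exact hgood' v hv
    · by_cases hxR : x ∈ uncovered cov B vs
      · obtain ⟨v, hv, hcov⟩ := h' x hxR
        exact ⟨v, List.mem_append_right _ hv, hcov⟩
      · rw [mem_uncovered] at hxR
        push Not at hxR
        obtain ⟨v, hv, hcov⟩ := hxR hx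
        exact ⟨v, List.mem_append_left _ hv, hcov⟩

end Greedy

section Step

open scoped Classical

variable {α β : Type*}

/-- **The pigeonhole step**: if `g` maps the `t`-tuples over `B` (`t ≥ 1`, `B` nonempty) into a
set of at most `D^t` values, then the most popular value `g x̄₀` is hit by at least `|B|^t / D^t`
tuples, whose coordinates therefore fill a part `S` of `B` with `|S|^t ≥ |B|^t / D^t`, i.e.
`D |S| ≥ |B|` (printed: the preimage of the most frequent transcript `τ*` lies in `G^{t(s)}` for the
set `G` it covers, whence `|G| ≥ φ(s) |F|`). [cite: DellVanmelkebeek2014, §6.1 proof of Lemma 4] -/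
theorem cover_step {t : ℕ} (ht : 1 ≤ t) (g : (Fin t → α) → β) (V : Finset β) (D : ℕ)
    (hV : V.card ≤ D ^ t) (B : Finset α) (hB : B.Nonempty)
    (hg : ∀ xb ∈ Fintype.piFinset (fun _ : Fin t => B), g xb ∈ V) :
    ∃ xb₀ ∈ Fintype.piFinset (fun _ : Fin t => B), ∃ S ⊆ B,
      (∀ x ∈ S, ∃ xb ∈ Fintype.piFinset (fun _ : Fin t => B), g xb = g xb₀ ∧ ∃ i, xb i = x) ∧
        B.card ≤ D * S.card := by
  set S := Fintype.piFinset (fun _ : Fin t => B) with hS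
  have hScard : S.card = B.card ^ t := Fintype.card_piFinset_const B t
  have hSne : S.Nonempty := by
    rw [← card_pos, hScard]
    exact pow_pos (card_pos.2 hB) t
  obtain ⟨xb₀, hxb₀, hmax⟩ := exists_max_image S (fun xb => (S.filter fun z => g z = g xb).card) hSne
  set m := (S.filter fun z => g z = g xb₀).card with hm
  set Sv := B.filter fun x => ∃ xb ∈ S, g xb = g xb₀ ∧ ∃ i, xb i = x with hSv
  refine ⟨xb₀, hxb₀, Sv, filter_subset _ _, fun x hx => (mem_filter.1 hx).2, ?_⟩
  -- `|S| ≤ m |image| ≤ m D^t`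
  have h1 : S.card ≤ m * (S.image g).card := by
    refine card_le_mul_card_image S m fun b hb => ?_
    obtain ⟨z, hz, rfl⟩ := mem_image.1 hb
    exact hmax z hz
  have h2 : (S.image g).card ≤ D ^ t :=
    (card_le_card (image_subset_iff.2 hg)).trans hV
  -- the popular fibre lies in the tuples over `Sv`
  have h3 : m ≤ Sv.card ^ t := by
    rw [hm, ← Fintype.card_piFinset_const Sv t]
    refine card_le_card fun xb hxb => ?_
    rw [mem_filter] at hxb
    rw [Fintype.mem_piFinset]
    intro i
    rw [hSv, mem_filter]
    exact ⟨Fintype.mem_piFinset.1 hxb.1 i, xb, hxb.1, hxb.2, i, rfl⟩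
  have h4 : B.card ^ t ≤ (D * Sv.card) ^ t := by
    calc B.card ^ t = S.card := hScard.symm
      _ ≤ m * (S.image g).card := h1
      _ ≤ Sv.card ^ t * D ^ t := Nat.mul_le_mul h3 h2
      _ = (D * Sv.card) ^ t := by rw [mul_pow, mul_comm]
  exact (Nat.pow_le_pow_iff_left (by omega)).1 h4

end Step

section Analysis

/-- `ℓ ≤ C t log t` with `C ≤ c₀` gives `2^ℓ ≤ t^{c₀ t}` (`2 ≤ e`, `exp (c₀ t log t) = t^{c₀ t}`):
the arithmetic behind "`1/φ(s) = 2^{(c(s)+1)/t(s)}` is polynomially bounded in `t(s)` as long as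
`c(s) = O(t(s) log t(s))`". [cite: DellVanmelkebeek2014, §6.1 proof of Lemma 4] -/
theorem two_pow_le_pow_mul {ℓ t c₀ : ℕ} {C : ℝ} (ht : 1 ≤ t) (hC : C ≤ c₀)
    (h : (ℓ : ℝ) ≤ C * ((t : ℝ) * Real.log t)) : 2 ^ ℓ ≤ t ^ (c₀ * t) := by
  have ht1 : (1 : ℝ) ≤ t := by exact_mod_cast ht
  have ht0 : (0 : ℝ) < t := by linarith
  have hlog : 0 ≤ Real.log t := Real.log_nonneg ht1
  have htl : 0 ≤ (t : ℝ) * Real.log t := mul_nonneg ht0.le hlog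
  have h1 : (ℓ : ℝ) ≤ c₀ * (t * Real.log t) := h.trans (mul_le_mul_of_nonneg_right hC htl)
  have h2 : (2 : ℝ) ^ ℓ ≤ Real.exp ℓ := by
    have he : (2 : ℝ) ≤ Real.exp 1 := by
      have := Real.add_one_le_exp (1 : ℝ)
      norm_num at this
      exact this
    calc (2 : ℝ) ^ ℓ ≤ (Real.exp 1) ^ ℓ := pow_le_pow_left₀ (by norm_num) he ℓ
      _ = Real.exp ℓ := by rw [← Real.exp_nat_mul, mul_one]
  have h3 : Real.exp ℓ ≤ Real.exp (c₀ * (t * Real.log t)) := Real.exp_le_exp.2 h1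
  have h4 : Real.exp ((c₀ : ℝ) * (t * Real.log t)) = (t : ℝ) ^ (c₀ * t) := by
    rw [← mul_assoc, show ((c₀ : ℝ) * t) = ((c₀ * t : ℕ) : ℝ) by push_cast; ring, Real.exp_nat_mul,
      Real.exp_log ht0]
  have h5 : ((2 ^ ℓ : ℕ) : ℝ) ≤ ((t ^ (c₀ * t) : ℕ) : ℝ) := by
    push_cast
    rw [← h4]
    exact h2.trans h3
  exact_mod_cast h5

/-- `ℓ ≤ C t log t` with `C ≤ c₀` gives `ℓ ≤ c₀ t²` (`log t ≤ t`). [folklore] -/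
theorem le_mul_sq {ℓ t c₀ : ℕ} {C : ℝ} (ht : 1 ≤ t) (hC : C ≤ c₀)
    (h : (ℓ : ℝ) ≤ C * ((t : ℝ) * Real.log t)) : ℓ ≤ c₀ * t ^ 2 := by
  have ht1 : (1 : ℝ) ≤ t := by exact_mod_cast ht
  have ht0 : (0 : ℝ) < t := by linarith
  have hlog : 0 ≤ Real.log t := Real.log_nonneg ht1
  have hlogle : Real.log t ≤ t := (Real.log_le_sub_one_of_pos ht0).trans (by linarith)
  have htl : 0 ≤ (t : ℝ) * Real.log t := mul_nonneg ht0.le hlog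
  have hc₀ : (0 : ℝ) ≤ c₀ := Nat.cast_nonneg _
  have h1 : (ℓ : ℝ) ≤ c₀ * (t * Real.log t) := h.trans (mul_le_mul_of_nonneg_right hC htl)
  have h2 : (c₀ : ℝ) * (t * Real.log t) ≤ c₀ * (t * t) :=
    mul_le_mul_of_nonneg_left (mul_le_mul_of_nonneg_left hlogle ht0.le) hc₀
  have h3 : ((ℓ : ℕ) : ℝ) ≤ ((c₀ * t ^ 2 : ℕ) : ℝ) := by
    push_cast
    nlinarith [h1, h2]
  exact_mod_cast h3

end Analysis


/-! ### The witness format and the typed verifier -/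

/-- The `T` items read off a witness string `y` regarded as a nested-pair list
(`nthItemFn ⟨1ⁱ, y⟩ = fstF (sndF^i y)`; total in `y`). [cite: AroraBarak2009, §0.1] -/
noncomputable def items (T : ℕ) (y : List Bool) : List (List Bool) :=
  (List.range T).map fun i => nthItemFn (boolPair (ones i) y)

/-- `items T y` has exactly `T` items. [folklore] -/
@[simp] theorem length_items (T : ℕ) (y : List Bool) : (items T y).length = T := by
  simp [items]

/-- On the code of a list of `T` strings, `items T` returns the list (item `i` of `encList xs` is
`xs[i]`: `HashBricks.nthItemFn_body`, `encList = OracleCompose.body`; the one-line bridge is the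
tree's `nthItemFn_encList` of `GoldwasserSipserRefereeBricks.lean`, not imported here). [folklore] -/
theorem items_encList (xs : List (List Bool)) : items xs.length (encList xs) = xs := by
  apply List.ext_getElem
  · simp
  · intro i h1 h2
    simp only [items, List.getElem_map, List.getElem_range]
    rw [← body_eq_encList, nthItemFn_body]
    exact List.getD_eq_getElem _ _ h2

/-- **Reading the items of a witness is polynomial time**: `(1ᵀ, y) ↦ items T y`.
[cite: AroraBarak2009, §1.3 (bounded loops)] -/
theorem strItems : CodeFP (pairE unE strE) (rawE strE) (fun p => items p.1 p.2) := by
  have hT : CodeFP (pairE (pairE unE strE) natE) unE (fun q => q.1.1) := (fst _ _).fst'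
  have hy : CodeFP (pairE (pairE unE strE) natE) strE (fun q => q.1.2) := (fst _ _).snd'
  have hi : CodeFP (pairE (pairE unE strE) natE) natE (fun q => q.2) := snd _ _
  have hnth : CodeFP (pairE unE strE) strE (fun r => nthItemFn (boolPair (unE r.1) r.2)) :=
    ⟨nthItemFn, nthItemFn_mem_FP, fun r => by simp only [pairE_apply, id_eq]⟩
  have hg : CodeFP (pairE (pairE unE strE) natE) strE
      (fun q => nthItemFn (boolPair (unE (min q.2 q.1.1)) q.1.2)) :=
    (hnth.comp ((unOfNatMin.comp (hT.pair hi)).pair hy) :)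
  have hall : CodeFP (pairE unE strE) (rawE strE)
      (fun p => (List.range p.1).map (fun a => nthItemFn (boolPair (unE (min a p.1)) p.2))) :=
    ((map hg).comp ((CodeFP.id (pairE unE strE)).pair (urange.comp (fst unE strE))) :)
  refine hall.congr fun p => ?_
  refine List.map_congr_left fun i hi => ?_
  rw [min_eq_left (List.mem_range.1 hi).le, unE_eq_ones]

/-- The compressed value of a tuple at length parameter `n`: `f ⟨encList xs, 1ⁿ⟩`. [cite: DellVanmelkebeek2014, §6.1] -/
def Fv (f : List Bool → List Bool) (n : ℕ) (xs : List (List Bool)) : List Bool :=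
  f (boolPair (encList xs) (List.replicate n true))

/-- The input type of the verifier: `((x, (t(n), advice list)), witness)`. [folklore] -/
abbrev VIn : Type := (List Bool × (ℕ × List (List Bool))) × List Bool

/-- Its code: `⟨⟨x, ⟨1^{t(n)}, encList Y⟩⟩, y⟩`. [folklore] -/
abbrev vinE : VIn → List Bool := pairE (pairE strE (pairE unE (rawE strE))) strE

/-- **The verifier's bit**: the witness `y` lists `t(n)` strings containing `x`, all of length
`≤ |x|`, whose compressed value is one of the advice strings (the proof system of the printed
proof: guess a tuple containing `x`, compute its transcript, check it against the advice).
[cite: DellVanmelkebeek2014, §6.1 proof of Lemma 4] -/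
noncomputable def vbit (f : List Bool → List Bool) (w : VIn) : Bool :=
  decide (w.1.1 ∈ items w.1.2.1 w.2) &&
    (((items w.1.2.1 w.2).all fun x' => decide (x'.length ≤ w.1.1.length)) &&
      decide (Fv f w.1.1.length (items w.1.2.1 w.2) ∈ w.1.2.2))

/-- **The verifier runs in polynomial time** (printed: the running time of the proof system is
polynomially bounded in `s` and `t(s)`), assembled in the `CodeFP` algebra: item extraction
`strItems`, list membership `CodeFP.mem`, the scan `CodeFP.all`, and the given `f ∈ FP`.
[cite: DellVanmelkebeek2014, §6.1 proof of Lemma 4] -/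
theorem vbit_codeFP {f : List Bool → List Bool} (hf : f ∈ FP) : CodeFP vinE bitE (vbit f) := by
  have hx : CodeFP vinE strE (fun w => w.1.1) := (fst _ _).fst'
  have hT : CodeFP vinE unE (fun w => w.1.2.1) := (fst _ _).snd'.fst'
  have hY : CodeFP vinE (rawE strE) (fun w => w.1.2.2) := (fst _ _).snd'.snd'
  have hy : CodeFP vinE strE (fun w => w.2) := snd _ _
  have hxs : CodeFP vinE (rawE strE) (fun w => items w.1.2.1 w.2) := (strItems.comp (hT.pair hy) :)
  have hinj : Function.Injective strE := fun _ _ h => h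
  have h1 : CodeFP vinE bitE (fun w => decide (w.1.1 ∈ items w.1.2.1 w.2)) :=
    ((mem hinj).comp (hx.pair hxs) :)
  have hp : CodeFP (pairE strE strE) bitE (fun q => decide (q.2.length ≤ q.1.length)) :=
    (natLe.comp ((strNatLength.comp (snd strE strE)).pair (strNatLength.comp (fst strE strE))) :)
  have h2 : CodeFP vinE bitE
      (fun w => (items w.1.2.1 w.2).all fun x' => decide (x'.length ≤ w.1.1.length)) :=
    ((all hp).comp (hx.pair hxs) :)
  have hF : CodeFP (pairE (rawE strE) unE) strE (fun q => Fv f q.2 q.1) :=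
    of_fn f hf fun q => by
      show f (boolPair (encList (q.1.map id)) (unE q.2)) =
        f (boolPair (encList q.1) (List.replicate q.2 true))
      rw [List.map_id, unE_eq_ones]
  have h3v : CodeFP vinE strE (fun w => Fv f w.1.1.length (items w.1.2.1 w.2)) :=
    (hF.comp (hxs.pair (strLength.comp hx)) :)
  have h3 : CodeFP vinE bitE (fun w => decide (Fv f w.1.1.length (items w.1.2.1 w.2) ∈ w.1.2.2)) :=
    ((mem hinj).comp (h3v.pair hY) :)
  exact (h1.and (h2.and h3)).congr fun _ => rfl

/-- **The verifier's language is in `P`**: some `V ∈ P` contains `⟨⟨x, ⟨1ᵀ, encList Y⟩⟩, y⟩` iff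
`vbit f ((x, (T, Y)), y)` (the typed bit `vbit_codeFP` read through the one-bit test `w = [1]`,
`mem_P_of_mem_FP`; cf. the tree's `LFKN.setOf_codeFP_mem_P`, whose `MIP = NEXP` file is not
imported here). [cite: DellVanmelkebeek2014, §6.1 proof of Lemma 4] -/
theorem exists_verifier {f : List Bool → List Bool} (hf : f ∈ FP) :
    ∃ V ∈ Classes.P, ∀ w : VIn, vinE w ∈ V ↔ vbit f w = true := by
  obtain ⟨G, hG, hGv⟩ := vbit_codeFP hf
  have hinj : Function.Injective strE := fun _ _ h => h
  have htest : CodeFP strE bitE (fun w : List Bool => decide (w = [true])) :=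
    ((CodeFP.eq hinj).comp ((CodeFP.id strE).pair (const strE [true])) :)
  have hdec : CodeFP strE bitE (fun w => decide (G w = [true])) :=
    (htest.comp (of_fn (eα := strE) (eβ := strE) (g := G) G hG fun _ => rfl) :)
  obtain ⟨F, hF, hFs⟩ := hdec
  have hP : ({z | decide (G z = [true]) = true} : Language Bool) ∈ Classes.P := by
    refine mem_P_of_mem_FP hF _ fun z => ⟨fun hz => ?_, fun hz => ?_⟩
    · rw [show F z = bitE (decide (G z = [true])) from hFs z, show decide (G z = [true]) = true from hz]
      rfl
    · rw [show F z = bitE (decide (G z = [true])) from hFs z, Bool.eq_false_iff.2 hz]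
      rfl
  refine ⟨{z | decide (G z = [true]) = true}, hP, fun w => ?_⟩
  show decide (G (vinE w) = [true]) = true ↔ vbit f w = true
  rw [decide_eq_true_iff, show G (vinE w) = bitE (vbit f w) from hGv w]
  simp [bitE]


/-- The compression hypothesis read on the list code `encList` (`= xs.foldr boolPair []`, the
iterated pairing of the route statement; cf. `FortnowSanthanam.foldr_boolPair_nil`).
[cite: DellVanmelkebeek2014, Lemma 4] -/
theorem isORCompressionAt_Fv {L : Language Bool} {A : Set (List Bool)} {f : List Bool → List Bool}
    {c t : ℕ → ℕ} (hcomp : IsORCompressionAt L f A c t) {n : ℕ} {xs : List (List Bool)}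
    (hlen : xs.length = t n) (hle : ∀ x ∈ xs, x.length ≤ n) :
    (Fv f n xs).length ≤ c n ∧ (Fv f n xs ∈ A ↔ ∃ x ∈ xs, x ∈ L) := by
  have hfold : ∀ l : List (List Bool), l.foldr boolPair [] = encList l := by
    intro l
    induction l with
    | nil => rfl
    | cons a l ih => rw [List.foldr_cons, ih, encList_cons]
  have h := hcomp n xs hlen hle
  rwa [hfold] at h

section Cover

open scoped Classical

/-- The strings of length `n`. [folklore] -/
noncomputable def strsEq (n : ℕ) : Finset (List Bool) := (univ : Finset (Fin n → Bool)).image List.ofFn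

/-- Membership in `strsEq n`. [folklore] -/
theorem mem_strsEq {n : ℕ} {x : List Bool} : x ∈ strsEq n ↔ x.length = n := by
  constructor
  · intro h
    obtain ⟨v, -, rfl⟩ := mem_image.1 h
    exact List.length_ofFn
  · intro h
    subst h
    exact mem_image.2 ⟨x.get, mem_univ _, List.ofFn_get x⟩

/-- There are at most `2ⁿ` strings of length `n`. [folklore] -/
theorem card_strsEq_le (n : ℕ) : (strsEq n).card ≤ 2 ^ n :=
  card_image_le.trans (by simp)

/-- The strings of length `≤ ℓ`. [folklore] -/
noncomputable def strsLe (ℓ : ℕ) : Finset (List Bool) := (range (ℓ + 1)).biUnion fun m => strsEq m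

/-- A string of length `≤ ℓ` is in `strsLe ℓ`. [folklore] -/
theorem mem_strsLe_of_length_le {ℓ : ℕ} {v : List Bool} (hv : v.length ≤ ℓ) : v ∈ strsLe ℓ :=
  mem_biUnion.2 ⟨v.length, mem_range.2 (Nat.lt_succ_of_le hv), mem_strsEq.2 rfl⟩

/-- There are at most `2^{ℓ+1}` strings of length `≤ ℓ` (printed: "at most `2^{c(s)+1}` distinct
transcripts"; `∑_{m ≤ ℓ} 2^m ≤ 2^{ℓ+1}`). [folklore] -/
theorem card_strsLe_le (ℓ : ℕ) : (strsLe ℓ).card ≤ 2 ^ (ℓ + 1) := by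
  have hsum : ∀ n, ∑ m ∈ range (n + 1), 2 ^ m ≤ 2 ^ (n + 1) := by
    intro n
    induction n with
    | zero => simp
    | succ n ih => rw [sum_range_succ, pow_succ]; omega
  exact card_biUnion_le.trans ((sum_le_sum fun m _ => card_strsEq_le m).trans (hsum ℓ))

end Cover


section MainCover

open scoped Classical

/-- **The cover of one length.** For every `n` (with `s := n`) and every `D ≥ 1` with
`2^{c(n)+1} ≤ D^{t(n)}` there is a list `Y` of at most `D (n + 1)` strings outside `A`, each of
length `≤ c(n)` (compressed values of tuples of non-members), such that every non-member `x` of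
length `n` sits in a `t(n)`-tuple of strings of length `≤ n` whose compressed value is in `Y`.
[cite: DellVanmelkebeek2014, §6.1 proof of Lemma 4] -/
theorem exists_cover {L : Language Bool} {A : Set (List Bool)} {f : List Bool → List Bool}
    {c t : ℕ → ℕ} (ht : ∀ s, 0 < t s) (hcomp : IsORCompressionAt L f A c t) (n D : ℕ)
    (hD : 1 ≤ D) (hDt : 2 ^ (c n + 1) ≤ D ^ t n) :
    ∃ Y : List (List Bool), (∀ v ∈ Y, v ∉ A ∧ v.length ≤ c n) ∧
      (∀ x : List Bool, x.length = n → x ∉ L → ∃ xs : List (List Bool), xs.length = t n ∧ x ∈ xs ∧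
        (∀ x' ∈ xs, x'.length ≤ n) ∧ Fv f n xs ∈ Y) ∧
      Y.length ≤ D * (n + 1) := by
  set B₀ : Finset (List Bool) := (strsEq n).filter fun x => x ∉ L with hB₀
  have hmemB₀ : ∀ x, x ∈ B₀ ↔ x.length = n ∧ x ∉ L := fun x => by
    rw [hB₀, mem_filter, mem_strsEq]
  let cov : List Bool → List Bool → Prop := fun v x => ∃ xs : List (List Bool), xs.length = t n ∧
    x ∈ xs ∧ (∀ x' ∈ xs, x'.length ≤ n) ∧ Fv f n xs = v
  let good : List Bool → Prop := fun v => v ∉ A ∧ v.length ≤ c n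
  have step : ∀ B ⊆ B₀, B.Nonempty → ∃ v, good v ∧ ∃ S ⊆ B, (∀ x ∈ S, cov v x) ∧
      B.card ≤ D * S.card := by
    intro B hB hBne
    have hBmem : ∀ x ∈ B, x.length = n ∧ x ∉ L := fun x hx => (hmemB₀ x).1 (hB hx)
    let g : (Fin (t n) → List Bool) → List Bool := fun xb => Fv f n (List.ofFn xb)
    have hofFn : ∀ xb ∈ Fintype.piFinset (fun _ : Fin (t n) => B), (List.ofFn xb).length = t n ∧
        (∀ x' ∈ List.ofFn xb, x'.length ≤ n) ∧ ∀ x' ∈ List.ofFn xb, x' ∉ L := by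
      intro xb hxb
      rw [Fintype.mem_piFinset] at hxb
      refine ⟨List.length_ofFn, fun x' hx' => ?_, fun x' hx' => ?_⟩
      · obtain ⟨i, rfl⟩ := List.mem_ofFn.1 hx'
        exact (hBmem _ (hxb i)).1.le
      · obtain ⟨i, rfl⟩ := List.mem_ofFn.1 hx'
        exact (hBmem _ (hxb i)).2
    have hg : ∀ xb ∈ Fintype.piFinset (fun _ : Fin (t n) => B), g xb ∈ strsLe (c n) := by
      intro xb hxb
      obtain ⟨hlen, hle, -⟩ := hofFn xb hxb
      exact mem_strsLe_of_length_le (isORCompressionAt_Fv hcomp hlen hle).1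
    obtain ⟨xb₀, hxb₀, S, hSB, hS, hcard⟩ :=
      cover_step (ht n) g (strsLe (c n)) D ((card_strsLe_le _).trans hDt) B hBne hg
    obtain ⟨hlen₀, hle₀, hnL₀⟩ := hofFn xb₀ hxb₀
    have hc₀ := isORCompressionAt_Fv hcomp hlen₀ hle₀
    refine ⟨g xb₀, ⟨fun hA => ?_, hc₀.1⟩, S, hSB, fun x hx => ?_, hcard⟩
    · obtain ⟨x', hx', hx'L⟩ := hc₀.2.1 hA
      exact hnL₀ x' hx' hx'L
    · obtain ⟨xb, hxb, hgeq, i, rfl⟩ := hS x hx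
      obtain ⟨hlen, hle, -⟩ := hofFn xb hxb
      exact ⟨List.ofFn xb, hlen, List.mem_ofFn.2 ⟨i, rfl⟩, hle, hgeq⟩
  have hcardB₀ : B₀.card ≤ 2 ^ n := (card_filter_le _ _).trans (card_strsEq_le n)
  obtain ⟨vs, hlen, hgood, hcov⟩ := greedy_cover B₀ cov good hD step n B₀ Subset.rfl hcardB₀
  refine ⟨vs, hgood, fun x hx hxL => ?_, hlen⟩
  obtain ⟨v, hv, xs, hxs, hxxs, hle, hFv⟩ := hcov x ((hmemB₀ x).2 ⟨hx, hxL⟩)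
  exact ⟨xs, hxs, hxxs, hle, hFv ▸ hv⟩

end MainCover

/-! ### Assembly -/

/-- A sum of `k` terms each `≤ b` is `≤ k b`. [folklore] -/
theorem sum_map_le_length_mul {α : Type*} (l : List α) (g : α → ℕ) (b : ℕ) (h : ∀ a ∈ l, g a ≤ b) :
    (l.map g).sum ≤ l.length * b := by
  induction l with
  | nil => simp
  | cons a l ih =>
    rw [List.map_cons, List.sum_cons, List.length_cons]
    have h1 := h a (by simp)
    have h2 := ih fun x hx => h x (by simp [hx])
    nlinarith

end ComplementaryWitness

open ComplementaryWitness in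
/-- **Dell–van Melkebeek (2010/2014), Lemma 4 (Complementary Witness Lemma), mapping case —
discharge of `complementaryWitness_mapping`.** Proof as printed in §6.1 (the Fortnow–Santhanam
case): with `s := n = |x|`, greedily choose compressed values `v ∉ A` of `t(n)`-tuples of
non-members of length `n`; by pigeonhole every step covers a fraction `≥ 1/D(n)` of the remaining
non-members, `D(n) = 2 t(n)^{⌈C⌉}` (from `c(n) ≤ C t(n) log t(n)`, i.e. `1/φ(s) = 2^{(c(s)+1)/t(s)}`
polynomially bounded), so `D(n)(n+1)` values suffice (advice: `1^{t(n)}` and this list); `x ∉ L` iff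
some `t(n)`-tuple of strings of length `≤ n` containing `x` compresses into the list — an `NP`
predicate with advice, so `L ∈ coNP/poly`. Lengths `n < s₀` get the same construction with
`D(n) = 2^{c(n)+1}` (finitely many, absorbed in the constant of the advice polynomial).
[cite: DellVanmelkebeek2014, Lemma 4 and §6.1] -/
theorem complementaryWitness_mapping_holds : complementaryWitness_mapping := by
  intro L A t c f ht hpoly hf hcomp hcost
  obtain ⟨p, hp⟩ := hpoly
  obtain ⟨C, s₀, hC⟩ := hcost
  -- constants
  set c₀ : ℕ := ⌈C⌉₊ with hc₀
  have hCc₀ : C ≤ (c₀ : ℝ) := Nat.le_ceil C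
  have ht1 : ∀ n, 1 ≤ t n := fun n => ht n
  have hcn : ∀ n, s₀ ≤ n → c n ≤ c₀ * t n ^ 2 := fun n hn => le_mul_sq (ht1 n) hCc₀ (hC n hn)
  have h2cn : ∀ n, s₀ ≤ n → 2 ^ c n ≤ t n ^ (c₀ * t n) := fun n hn =>
    two_pow_le_pow_mul (ht1 n) hCc₀ (hC n hn)
  -- the covering ratio `D`
  let D : ℕ → ℕ := fun n => if s₀ ≤ n then 2 * t n ^ c₀ else 2 ^ (c n + 1)
  have hD1 : ∀ n, 1 ≤ D n := by
    intro n
    simp only [D]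
    split_ifs
    · have := Nat.one_le_pow c₀ (t n) (ht n)
      omega
    · exact Nat.one_le_two_pow
  have hDt : ∀ n, 2 ^ (c n + 1) ≤ D n ^ t n := by
    intro n
    simp only [D]
    split_ifs with hn
    · rw [mul_pow, ← pow_mul, pow_succ]
      have h1 : 2 ≤ 2 ^ t n := by
        calc (2 : ℕ) = 2 ^ 1 := by norm_num
          _ ≤ 2 ^ t n := Nat.pow_le_pow_right (by norm_num) (ht1 n)
      calc 2 ^ c n * 2 ≤ t n ^ (c₀ * t n) * 2 ^ t n := Nat.mul_le_mul (h2cn n hn) h1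
        _ = 2 ^ t n * t n ^ (c₀ * t n) := mul_comm _ _
    · exact Nat.le_self_pow (by have := ht n; omega) _
  -- the covers, length by length
  have hcov := fun n => exists_cover ht hcomp n (D n) (hD1 n) (hDt n)
  choose Y hYgood hYcov hYlen using hcov
  -- the advice `⟨1^{t n}, encList (Y n)⟩`
  let a : ℕ → List Bool := fun n => boolPair (unE (t n)) (rawE strE (Y n))
  have hlen_a : ∀ n, (a n).length = 2 * t n + 2 + ((Y n).map fun v => 2 * v.length + 2).sum := by
    intro n
    simp only [a, length_boolPair, length_unE, length_rawE]
    rfl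
  -- the verifier and the `NP` language `K` (complement of the `coNP` language)
  obtain ⟨V, hV, hVw⟩ := exists_verifier hf
  let q : Polynomial ℕ := p * (2 * X + 2)
  let K : Language Bool := {z | ∃ y : List Bool, y.length ≤ q.eval z.length ∧ boolPair z y ∈ V}
  have hK : K ∈ Nondeterministic.NP := ⟨V, hV, q, fun z => Iff.rfl⟩
  -- the advice polynomial
  let S₀ : ℕ := ∑ m ∈ range s₀, (a m).length
  let P : Polynomial ℕ :=
    2 * p + 2 + 2 * p ^ c₀ * (X + 1) * (2 * (Polynomial.C c₀ * p ^ 2) + 2) + Polynomial.C S₀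
  have hPeval : ∀ n, P.eval n =
      2 * p.eval n + 2 + 2 * p.eval n ^ c₀ * (n + 1) * (2 * (c₀ * p.eval n ^ 2) + 2) + S₀ := by
    intro n
    simp only [P, eval_add, eval_mul, eval_pow, eval_C, eval_X, eval_ofNat, eval_one]
  refine ⟨Kᶜ, ?_, a, P, fun n => ?_, fun x => ?_⟩
  · -- `Kᶜ ∈ coNP`
    show Kᶜᶜ ∈ Nondeterministic.NP
    rwa [compl_compl]
  · -- advice length
    rw [hPeval]
    by_cases hn : s₀ ≤ n
    · have hDn : D n = 2 * t n ^ c₀ := if_pos hn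
      have htp : t n ≤ p.eval n := hp n
      have hk : (Y n).length ≤ 2 * p.eval n ^ c₀ * (n + 1) := by
        calc (Y n).length ≤ D n * (n + 1) := hYlen n
          _ = 2 * t n ^ c₀ * (n + 1) := by rw [hDn]
          _ ≤ 2 * p.eval n ^ c₀ * (n + 1) :=
            Nat.mul_le_mul_right _ (Nat.mul_le_mul_left 2 (Nat.pow_le_pow_left htp c₀))
      have hcn' : c n ≤ c₀ * p.eval n ^ 2 :=
        (hcn n hn).trans (Nat.mul_le_mul_left c₀ (Nat.pow_le_pow_left htp 2))
      have hsum : ((Y n).map fun v => 2 * v.length + 2).sum ≤ (Y n).length * (2 * c n + 2) :=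
        sum_map_le_length_mul _ _ _ fun v hv => by
          have := (hYgood n v hv).2
          omega
      have hsum' : ((Y n).map fun v => 2 * v.length + 2).sum ≤
          2 * p.eval n ^ c₀ * (n + 1) * (2 * (c₀ * p.eval n ^ 2) + 2) :=
        hsum.trans (Nat.mul_le_mul hk (by omega))
      rw [hlen_a]
      omega
    · have h1 : (a n).length ≤ S₀ :=
        single_le_sum (f := fun m => (a m).length) (fun _ _ => Nat.zero_le _)
          (mem_range.2 (Nat.lt_of_not_le hn))
      omega
  · -- the equivalence
    have hw : ∀ y, boolPair (boolPair x (a x.length)) y ∈ V ↔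
        vbit f ((x, (t x.length, Y x.length)), y) = true :=
      fun y => hVw ((x, (t x.length, Y x.length)), y)
    show x ∈ L ↔ ¬ ∃ y : List Bool, y.length ≤ q.eval (boolPair x (a x.length)).length ∧
      boolPair (boolPair x (a x.length)) y ∈ V
    constructor
    · rintro hxL ⟨y, -, hy⟩
      rw [hw] at hy
      simp only [vbit, Bool.and_eq_true, decide_eq_true_eq, List.all_eq_true] at hy
      obtain ⟨hxmem, hall, hFv⟩ := hy
      have hc := isORCompressionAt_Fv hcomp (n := x.length) (xs := items (t x.length) y)
        (length_items _ _) hall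
      exact (hYgood _ _ hFv).1 (hc.2.2 ⟨x, hxmem, hxL⟩)
    · intro h
      by_contra hxL
      apply h
      obtain ⟨xs, hlen, hxmem, hle, hFv⟩ := hYcov x.length x rfl hxL
      refine ⟨encList xs, ?_, ?_⟩
      · -- witness length
        set m := (boolPair x (a x.length)).length with hm
        have hnm : x.length ≤ m := by rw [hm, length_boolPair]; omega
        have hq : q.eval m = p.eval m * (2 * m + 2) := by
          simp only [q, eval_mul, eval_add, eval_X, eval_ofNat]
        rw [hq, length_encList]
        calc (xs.map fun a => 2 * a.length + 2).sum ≤ xs.length * (2 * x.length + 2) :=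
              sum_map_le_length_mul _ _ _ fun x' hx' => by have := hle x' hx'; omega
          _ ≤ p.eval m * (2 * m + 2) := by
              rw [hlen]
              exact Nat.mul_le_mul ((hp _).trans (TM2Iter.eval_mono p hnm)) (by omega)
      · rw [hw]
        simp only [vbit, Bool.and_eq_true, decide_eq_true_eq, List.all_eq_true]
        rw [← hlen, items_encList]
        exact ⟨hxmem, hle, hFv⟩

end Literature.Computability.Complexity
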